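import Summits.NavierStokesRegularity.NavierStokesRegularity.Theses.AxisymmetricExtremality
import Literature.Analysis.FluidPDE.SereginZajaczkowski2007
import Literature.Analysis.FluidPDE.SereginSverakAxisymmetric
import HarnessLib

/-!
# Seregin 2022, §2 Step 1: uniform bounds on the regular region by compactness, and the
# energy class / the swirl bound (2.2) for the continuous representative —
# crux stmt-NavierStokesRegularity-15453 (`AxisymmetricExtremality.AxisymmetricKatoGlobal`), line registered, support for stub `stub_sereginLogSwirlOrigin`

Support file (`--supports stmt-NavierStokesRegularity-15453`; theorems only, everything proved)
toward the registered stub `stub_sereginLogSwirlOrigin` = the named fact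
`Literature.Analysis.FluidPDE.seregin2022_logSwirl_regularAtOrigin` (G. Seregin, J. Math. Fluid
Mech. 24 (2022), Paper 27 = arXiv:2201.00153, §2).  Step 1 (arXiv p. 5) passes from "regular
points" to "`v ∈ C([-δ², 0]; C³(𝒞̄((0, h₁), δ)))` … In the set `supp |∇η|`, functions `v`, `∇v`,
and `∇²v` are bounded", i.e. from local derivative bounds on a backward cylinder at each regular
top-slice point to bounds that are UNIFORM on the compact set `supp ∇η` up to the top time; and
it silently replaces the suitable weak solution by its continuous representative in the energy
class and in (2.2) ("Without loss of generality, we may assume also that (2.2) holds in `𝒞`").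
In the tree's reduction (`seregin2022_logSwirl_regularAtOrigin_of_cleanRepr`, `…FinalReduction`)
the core hypothesis at `(0, 1)` gives a representative `V` (`IsSmoothAxisymmetricSolutionOn` on
`Q = 𝒞 × ]-1, 0[`, `v = V` a.e.) and, at every top-slice point `a ∈ 𝒞` off the axis or in the
two strips, a radius `ρ > 0` with `‖D_xⁿV‖ ≤ Cₙ` on `Q((0, a), ρ)`.  This file proves:

* `exists_uniform_bound_of_cylinders` — **compactness**: if every point `a` of a compact `K`
  has `ρ_a > 0` and `C_a` with `‖D_xⁿV‖ ≤ C_a` on the backward cylinder `Q((0, a), ρ_a)`, then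
  for some `ρ > 0`, `C`: `‖D_xⁿV(t, x)‖ ≤ C` for all `t ∈ ]-ρ², 0[`, `x ∈ K`;
* `exists_uniform_derivBounds` (registered sub-goal) — the same for `n = 0, 1, 2` at once, in
  the form `‖V t x‖ ≤ D₀`, `‖D(V t)(x)‖ ≤ D₁`, `‖D²(V t)(x)‖ ≤ D₂` consumed by
  `step3_pointwiseConstants` / `cut_bound` (`…Step1CutoffConstants`, `…Step1CutoffBcut`);
* `le_of_ae_le_of_continuousOn` — a continuous inequality valid a.e. on an open set holds
  everywhere on it (any measure charging open sets);
* `swirl_bound_repr` — **(2.2) for the representative**: the swirl bound of `v` on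
  `𝒞 × ]-1, 0[` off the axis passes to the continuous `V` (`v = V` a.e.);
* `exists_seq_tendsto_of_ae` — an a.e. property on `]-1, 0[` holds along a sequence tending to
  any prescribed time;
* `energy_bound_repr` — **the energy class for the representative at every time**: from
  `sup ess_t ∫_𝒞 |v|² ≤ C` and `v = V` a.e. to `∫_𝒞 |V(t)|² ≤ C` for EVERY `t ∈ ]-1, 0[`
  (Fubini for the a.e. identity, then Fatou along a sequence of good times and continuity of
  `V` on `Q`), the hypothesis `hA` of `isRegularAtOrigin_of_step3Bounds`;
* `aestronglyMeasurable_repr` — measurability of `V` on the sub-cylinders `Q(r)`.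

## Mathlib / tree search

Tree: `IsSmoothAxisymmetricSolutionOn.continuousOn_velocity` (`SereginZajaczkowski2007`),
`SereginSverak2009.mem_parCyl_zero`, `mem_spaceCyl`, `isOpen_parCyl`, `parCyl_mono`
(`SereginSverakAxisymmetric`), `parabolicCylinder`, `mem_parabolicCylinder` (`SuitableWeak`).
Mathlib: `IsCompact.elim_finite_subcover`, `Finset.exists_min_image`, `Measure.ae_ae_of_ae_prod`,
`Measure.prod_restrict`, `Measure.volume_eq_prod`, `lintegral_liminf_le'`, `IsOpen.measure_pos`,
`Tendsto.liminf_eq`, `LocallyIntegrableOn.aestronglyMeasurable`.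

## References

* G. Seregin, J. Math. Fluid Mech. 24 (2022), Paper No. 27 = arXiv:2201.00153, §2 Step 1 (arXiv
  p. 5). [`Seregin2022LocalAxisym`]
-/

noncomputable section

open Set Filter Topology Function Metric MeasureTheory
open scoped ENNReal NNReal
open Literature.Analysis.FluidPDE

-- `<Problem> = <Summit>` duplicates a namespace component by design (lakefile sets the same option).
set_option linter.dupNamespace false

namespace Summit.NavierStokesRegularity.NavierStokesRegularity.Theorems.AxisymmetricKatoGlobal.EulerScaling

/-! ### Compactness: uniform bounds on the regular region up to the top time -/

section Compact

variable {F : Type*} [NormedAddCommGroup F]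

/-- **From cylinders at every point to a uniform slab** (Step 1: "`v ∈ C([-δ², 0]; C³(𝒞̄(…, δ)))`"
and boundedness "in space-time" on `supp |∇η|`): if `K ⊆ ℝ³` is compact and every `a ∈ K` admits
`ρ > 0`, `C` with `‖Φ(t, x)‖ ≤ C` on the backward cylinder `Q((0, a), ρ) = ]-ρ², 0[ × B(a, ρ)`,
then for some `ρ > 0` and `C`, `‖Φ(t, x)‖ ≤ C` for all `t ∈ ]-ρ², 0[` and `x ∈ K` (finite
subcover by the balls `B(a, ρ_a)`, minimum radius, maximum constant). [cite: Seregin2022LocalAxisym, §2 Step 1 (arXiv:2201.00153 p. 5), boundedness in space-time on supp|∇η|] -/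
theorem exists_uniform_bound_of_cylinders {Φ : ℝ → EuclideanSpace ℝ (Fin 3) → F}
    {K : Set (EuclideanSpace ℝ (Fin 3))} (hK : IsCompact K)
    (h : ∀ a ∈ K, ∃ ρ > 0, ∃ C : ℝ, ∀ w ∈ parabolicCylinder ρ ((0 : ℝ), a), ‖Φ w.1 w.2‖ ≤ C) :
    ∃ ρ > 0, ∃ C : ℝ, ∀ t ∈ Ioo (-ρ ^ 2) 0, ∀ x ∈ K, ‖Φ t x‖ ≤ C := by
  choose! ρ hρ C hC using h
  -- finite subcover of `K` by the balls `B(a, ρ a)`, `a ∈ K`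
  obtain ⟨s, hs⟩ := hK.elim_finite_subcover (fun a : K => ball (a : EuclideanSpace ℝ (Fin 3)) (ρ a))
    (fun _ => isOpen_ball) fun x hx => mem_iUnion.2 ⟨⟨x, hx⟩, mem_ball_self (hρ x hx)⟩
  by_cases hse : s.Nonempty
  · obtain ⟨a₀, ha₀, hmin⟩ := s.exists_min_image (fun a : K => ρ a) hse
    refine ⟨ρ a₀, hρ a₀ a₀.2, ∑ a ∈ s, |C a|, fun t ht x hx => ?_⟩
    obtain ⟨a, ha, hxa⟩ : ∃ a ∈ s, x ∈ ball (a : EuclideanSpace ℝ (Fin 3)) (ρ a) := by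
      simpa only [mem_iUnion, exists_prop] using hs hx
    have hw : ((t, x) : ℝ × EuclideanSpace ℝ (Fin 3)) ∈ parabolicCylinder (ρ a) ((0 : ℝ), (a : EuclideanSpace ℝ (Fin 3))) := by
      rw [mem_parabolicCylinder]
      refine ⟨⟨?_, ht.2⟩, mem_ball.1 hxa⟩
      have h1 : ρ a₀ ^ 2 ≤ ρ a ^ 2 := pow_le_pow_left₀ (hρ a₀ a₀.2).le (hmin a ha) 2
      have h2 := ht.1
      simp only [zero_sub]
      linarith
    calc ‖Φ t x‖ ≤ C a := hC a a.2 (t, x) hw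
      _ ≤ |C a| := le_abs_self _
      _ ≤ ∑ b ∈ s, |C b| :=
          Finset.single_le_sum (s := s) (f := fun b : K => |C (b : EuclideanSpace ℝ (Fin 3))|)
            (fun b _ => abs_nonneg _) ha
  · have hKe : K = ∅ := by
      refine eq_empty_iff_forall_notMem.2 fun x hx => ?_
      have := hs hx
      simp only [mem_iUnion, exists_prop] at this
      obtain ⟨a, ha, -⟩ := this
      exact hse ⟨a, ha⟩
    exact ⟨1, one_pos, 0, fun t _ x hx => by simp [hKe] at hx⟩

/-- **Uniform bounds of `V, DV, D²V` on the regular region up to the top time.** If `K ⊆ ℝ³`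
is compact and every `a ∈ K` has `ρ > 0` such that for every order `n` the spatial derivative
`D_xⁿV` is bounded on `Q((0, a), ρ)` (the core hypothesis of
`seregin2022_logSwirl_regularAtOrigin_of_cleanRepr` at a regular top-slice point), then for some
`ρ > 0` and `D₀, D₁, D₂ ≥ 0`: `‖V t x‖ ≤ D₀`, `‖D(V t)(x)‖ ≤ D₁`, `‖D²(V t)(x)‖ ≤ D₂` for all
`t ∈ ]-ρ², 0[`, `x ∈ K` — the inputs of `step3_pointwiseConstants` and `cut_bound`, uniform on
the final slab. Registered sub-goal toward `stub_sereginLogSwirlOrigin`. [cite: Seregin2022LocalAxisym, §2 Step 1 (arXiv:2201.00153 p. 5), "In the set supp|∇η|, functions v, ∇v, and ∇²v are bounded"] -/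
theorem exists_uniform_derivBounds : ∀ (V : ℝ → EuclideanSpace ℝ (Fin 3) → EuclideanSpace ℝ (Fin 3)) (K : Set (EuclideanSpace ℝ (Fin 3))), IsCompact K → (∀ a ∈ K, ∃ ρ > 0, ∀ n : ℕ, ∃ C : ℝ, ∀ w ∈ parabolicCylinder ρ ((0 : ℝ), a), ‖iteratedFDeriv ℝ n (V w.1) w.2‖ ≤ C) → ∃ ρ > 0, ∃ D₀ D₁ D₂ : ℝ, 0 ≤ D₀ ∧ 0 ≤ D₁ ∧ 0 ≤ D₂ ∧ ∀ t ∈ Ioo (-ρ ^ 2) 0, ∀ x ∈ K, ‖V t x‖ ≤ D₀ ∧ ‖fderiv ℝ (V t) x‖ ≤ D₁ ∧ ‖iteratedFDeriv ℝ 2 (V t) x‖ ≤ D₂ := by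
  intro V K hK h
  have hn : ∀ n : ℕ, ∀ a ∈ K, ∃ ρ > 0, ∃ C : ℝ, ∀ w ∈ parabolicCylinder ρ ((0 : ℝ), a),
      ‖iteratedFDeriv ℝ n (V w.1) w.2‖ ≤ C := fun n a ha => by
    obtain ⟨ρ, hρ, hC⟩ := h a ha
    obtain ⟨C, hC⟩ := hC n
    exact ⟨ρ, hρ, C, hC⟩
  obtain ⟨ρ₀, hρ₀, C₀, h0⟩ := exists_uniform_bound_of_cylinders (Φ := fun t x => iteratedFDeriv ℝ 0 (V t) x) hK (hn 0)
  obtain ⟨ρ₁, hρ₁, C₁, h1⟩ := exists_uniform_bound_of_cylinders (Φ := fun t x => iteratedFDeriv ℝ 1 (V t) x) hK (hn 1)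
  obtain ⟨ρ₂, hρ₂, C₂, h2⟩ := exists_uniform_bound_of_cylinders (Φ := fun t x => iteratedFDeriv ℝ 2 (V t) x) hK (hn 2)
  set ρ : ℝ := min ρ₀ (min ρ₁ ρ₂) with hρdef
  have hρ : 0 < ρ := lt_min hρ₀ (lt_min hρ₁ hρ₂)
  have hsub : ∀ {ρ' : ℝ}, ρ ≤ ρ' → Ioo (-ρ ^ 2) 0 ⊆ Ioo (-ρ' ^ 2) (0 : ℝ) := fun {ρ'} hle t ht =>
    ⟨by nlinarith [ht.1, pow_le_pow_left₀ hρ.le hle 2], ht.2⟩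
  refine ⟨ρ, hρ, max C₀ 0, max C₁ 0, max C₂ 0, le_max_right _ _, le_max_right _ _, le_max_right _ _,
    fun t ht x hx => ⟨?_, ?_, ?_⟩⟩
  · have := h0 t (hsub (min_le_left _ _) ht) x hx
    rw [norm_iteratedFDeriv_zero] at this
    exact this.trans (le_max_left _ _)
  · have := h1 t (hsub ((min_le_right _ _).trans (min_le_left _ _)) ht) x hx
    rw [norm_iteratedFDeriv_one] at this
    exact this.trans (le_max_left _ _)
  · exact (h2 t (hsub ((min_le_right _ _).trans (min_le_right _ _)) ht) x hx).trans (le_max_left _ _)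

end Compact

/-! ### A.e. inequalities for continuous functions on open sets -/

section AE

/-- **A continuous inequality valid a.e. on an open set holds everywhere on it**, for any
measure charging open sets (the set where it fails is open and null, hence empty). General form
of the tree's `forall_le_of_ae_restrict_le_of_continuousOn` (`ℝ × ℝ³`, Squeeze-cycle side) and
`LeiZhang2011.le_of_ae_le_of_continuousOn` (constant bound). [folklore] -/
theorem le_of_ae_le_of_continuousOn {X : Type*} [TopologicalSpace X] [MeasurableSpace X]
    [OpensMeasurableSpace X] {μ : Measure X} [μ.IsOpenPosMeasure] {O : Set X} (hO : IsOpen O)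
    {F g : X → ℝ} (hF : ContinuousOn F O) (hg : ContinuousOn g O)
    (hae : ∀ᵐ z ∂(μ.restrict O), F z ≤ g z) : ∀ z ∈ O, F z ≤ g z := by
  by_contra hnot
  simp only [not_forall, not_le, exists_prop] at hnot
  obtain ⟨z₀, hz₀, hlt⟩ := hnot
  -- the bad set is open and nonempty, hence of positive measure
  have hbad : IsOpen (O ∩ (fun z => F z - g z) ⁻¹' Ioi 0) :=
    (hF.sub hg).isOpen_inter_preimage hO isOpen_Ioi
  have hz₀U : z₀ ∈ O ∩ (fun z => F z - g z) ⁻¹' Ioi 0 := ⟨hz₀, by simpa using hlt⟩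
  have hpos : 0 < μ (O ∩ (fun z => F z - g z) ⁻¹' Ioi 0) := hbad.measure_pos μ ⟨z₀, hz₀U⟩
  -- but it is null
  have hnull : μ.restrict O {z | ¬ F z ≤ g z} = 0 := ae_iff.1 hae
  rw [Measure.restrict_apply' hO.measurableSet] at hnull
  have hsub : O ∩ (fun z => F z - g z) ⁻¹' Ioi 0 ⊆ {z | ¬ F z ≤ g z} ∩ O := fun z hz =>
    ⟨not_le.2 (by simpa using hz.2), hz.1⟩
  exact hpos.ne' (measure_mono_null hsub hnull)

end AE

/-! ### (2.2) and the energy class for the representative -/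

section Repr

variable {v V : ℝ → EuclideanSpace ℝ (Fin 3) → EuclideanSpace ℝ (Fin 3)} {q : ℝ → EuclideanSpace ℝ (Fin 3) → ℝ}

/-- `Q = Q(0, 1)` is the product `]-1, 0[ × 𝒞`. [folklore] -/
theorem parCyl_zero_one_eq_prod :
    SereginSverak2009.parCyl (0 : ℝ × EuclideanSpace ℝ (Fin 3)) 1 =
      Ioo (-1 : ℝ) 0 ×ˢ SereginSverak2009.spaceCyl (0 : EuclideanSpace ℝ (Fin 3)) 1 := by
  ext z
  rw [SereginSverak2009.mem_parCyl_zero, mem_prod, SereginSverak2009.mem_spaceCyl, sub_zero, one_pow]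
  simp

/-- **The a.e. identity `v = V` on `Q`, sliced**: for a.e. `t ∈ ]-1, 0[`, `v t = V t` a.e. on `𝒞`
(Fubini–Tonelli for null sets). [folklore] -/
theorem ae_ae_eq_of_ae_eq_parCyl
    (hae : uncurry v =ᵐ[volume.restrict (SereginSverak2009.parCyl (0 : ℝ × EuclideanSpace ℝ (Fin 3)) 1)] uncurry V) :
    ∀ᵐ t ∂(volume.restrict (Ioo (-1 : ℝ) 0)),
      ∀ᵐ x ∂(volume.restrict (SereginSverak2009.spaceCyl (0 : EuclideanSpace ℝ (Fin 3)) 1)), v t x = V t x := by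
  rw [parCyl_zero_one_eq_prod, Measure.volume_eq_prod, ← Measure.prod_restrict] at hae
  exact Measure.ae_ae_of_ae_prod hae

/-- **(2.2) for the continuous representative** ("Without loss of generality, we may assume also
that (2.2) holds in `𝒞`"): if `|σ(v)| ≤ C₁/ln³(e/ϱ)` on `𝒞 × ]-1, 0[` off the axis and `v = V`
a.e. on `Q` with `V` continuous on `Q` (`IsSmoothAxisymmetricSolutionOn`), then the same bound
holds for `V` at EVERY point of `Q` off the axis. [cite: Seregin2022LocalAxisym, §2 Step 1 (arXiv:2201.00153 p. 5), (2.1)–(2.2)] -/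
theorem swirl_bound_repr (hV : SereginZajaczkowski2007.IsSmoothAxisymmetricSolutionOn
      (SereginSverak2009.parCylOpens 0 1) V q)
    (hae : uncurry v =ᵐ[volume.restrict (SereginSverak2009.parCyl (0 : ℝ × EuclideanSpace ℝ (Fin 3)) 1)] uncurry V)
    {C₁ : ℝ} (hσ : ∀ t ∈ Ioo (-1 : ℝ) 0, ∀ x ∈ SereginSverak2009.spaceCyl (0 : EuclideanSpace ℝ (Fin 3)) 1,
      0 < cylRadius x → |swirl (v t) x| ≤ C₁ / Real.log (Real.exp 1 / cylRadius x) ^ 3) :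
    ∀ t ∈ Ioo (-1 : ℝ) 0, ∀ x ∈ SereginSverak2009.spaceCyl (0 : EuclideanSpace ℝ (Fin 3)) 1,
      0 < cylRadius x → |swirl (V t) x| ≤ C₁ / Real.log (Real.exp 1 / cylRadius x) ^ 3 := by
  -- the open set `O = Q ∩ {ϱ > 0}`
  set O : Set (ℝ × EuclideanSpace ℝ (Fin 3)) :=
    SereginSverak2009.parCyl 0 1 ∩ {z | 0 < cylRadius z.2} with hO
  have hOo : IsOpen O := (SereginSverak2009.isOpen_parCyl 0 1).inter
    (isOpen_lt continuous_const (continuous_cylRadius.comp continuous_snd))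
  have hcont : ContinuousOn (uncurry V) (SereginSverak2009.parCyl 0 1) := hV.continuousOn_velocity
  -- `F = |swirl V|`, `g = C₁ / ln³(e/ϱ)` are continuous on `O`
  have hF : ContinuousOn (fun z : ℝ × EuclideanSpace ℝ (Fin 3) => |swirl (V z.1) z.2|) O := by
    have h0 : ContinuousOn (fun z : ℝ × EuclideanSpace ℝ (Fin 3) => (uncurry V z) 0) O :=
      ((EuclideanSpace.proj (0 : Fin 3)).continuous.comp_continuousOn hcont).mono inter_subset_left
    have h1 : ContinuousOn (fun z : ℝ × EuclideanSpace ℝ (Fin 3) => (uncurry V z) 1) O :=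
      ((EuclideanSpace.proj (1 : Fin 3)).continuous.comp_continuousOn hcont).mono inter_subset_left
    have hx0 : Continuous fun z : ℝ × EuclideanSpace ℝ (Fin 3) => z.2 0 :=
      (EuclideanSpace.proj (0 : Fin 3)).continuous.comp continuous_snd
    have hx1 : Continuous fun z : ℝ × EuclideanSpace ℝ (Fin 3) => z.2 1 :=
      (EuclideanSpace.proj (1 : Fin 3)).continuous.comp continuous_snd
    exact ((hx0.continuousOn.mul h1).sub (hx1.continuousOn.mul h0)).abs
  have hg : ContinuousOn (fun z : ℝ × EuclideanSpace ℝ (Fin 3) =>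
      C₁ / Real.log (Real.exp 1 / cylRadius z.2) ^ 3) O := by
    refine continuousOn_const.div ((ContinuousOn.log ?_ fun z hz => ?_).pow 3) fun z hz => ?_
    · exact continuousOn_const.div (continuous_cylRadius.comp continuous_snd).continuousOn
        fun z hz => (ne_of_gt hz.2)
    · exact (div_pos (Real.exp_pos 1) hz.2).ne'
    · have hz1 : cylRadius z.2 < 1 := by
        have := (SereginSverak2009.mem_parCyl_zero.1 hz.1).2.1
        simpa using this
      have hlog : 0 < Real.log (Real.exp 1 / cylRadius z.2) := by
        refine Real.log_pos ?_
        rw [lt_div_iff₀ hz.2]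
        have := Real.add_one_lt_exp (one_ne_zero)
        nlinarith
      exact (pow_pos hlog 3).ne'
  -- the inequality holds a.e. on `O`
  have haeO : ∀ᵐ z ∂(volume.restrict O), |swirl (V z.1) z.2| ≤ C₁ / Real.log (Real.exp 1 / cylRadius z.2) ^ 3 := by
    have h1 : ∀ᵐ z ∂(volume.restrict O), uncurry v z = uncurry V z :=
      ae_restrict_of_ae_restrict_of_subset inter_subset_left hae
    have h2 : ∀ᵐ z ∂(volume.restrict O), z ∈ O := ae_restrict_mem hOo.measurableSet
    filter_upwards [h1, h2] with z hz hzO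
    have ht : z.1 ∈ Ioo (-1 : ℝ) 0 := by
      have := (SereginSverak2009.mem_parCyl_zero.1 hzO.1).1
      simpa using this
    have hx : z.2 ∈ SereginSverak2009.spaceCyl (0 : EuclideanSpace ℝ (Fin 3)) 1 := by
      rw [SereginSverak2009.mem_spaceCyl, sub_zero]
      have := (SereginSverak2009.mem_parCyl_zero.1 hzO.1).2
      simpa using this
    have hsw : swirl (V z.1) z.2 = swirl (v z.1) z.2 := by
      simp only [swirl]
      have e : v z.1 z.2 = V z.1 z.2 := hz
      rw [e]
    rw [hsw]
    exact hσ z.1 ht z.2 hx hzO.2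
  intro t ht x hx hr
  have hz : ((t, x) : ℝ × EuclideanSpace ℝ (Fin 3)) ∈ O := by
    refine ⟨SereginSverak2009.mem_parCyl_zero.2 ⟨by simpa using ht, ?_, ?_⟩, hr⟩
    · have := (SereginSverak2009.mem_spaceCyl.1 hx).1; simpa using this
    · have := (SereginSverak2009.mem_spaceCyl.1 hx).2; simpa using this
  exact le_of_ae_le_of_continuousOn (μ := volume) hOo hF hg haeO (t, x) hz

/-- **An a.e. property on `]-1, 0[` holds along a sequence tending to any time of `]-1, 0[`**
(every neighbourhood has positive measure). [folklore] -/
theorem exists_seq_tendsto_of_ae {P : ℝ → Prop} (hP : ∀ᵐ t ∂(volume.restrict (Ioo (-1 : ℝ) 0)), P t)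
    {t₀ : ℝ} (ht₀ : t₀ ∈ Ioo (-1 : ℝ) 0) :
    ∃ u : ℕ → ℝ, (∀ n, u n ∈ Ioo (-1 : ℝ) 0 ∧ P (u n)) ∧ Tendsto u atTop (𝓝 t₀) := by
  have hnull : volume.restrict (Ioo (-1 : ℝ) 0) {t | ¬ P t} = 0 := ae_iff.1 hP
  have hstep : ∀ n : ℕ, ∃ t, (t ∈ Ioo (-1 : ℝ) 0 ∧ P t) ∧ dist t t₀ < 1 / (n + 1) := by
    intro n
    by_contra hcon
    simp only [not_exists, not_and, not_lt, and_imp] at hcon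
    set J : Set ℝ := ball t₀ (1 / (n + 1)) ∩ Ioo (-1 : ℝ) 0 with hJ
    have hJo : IsOpen J := isOpen_ball.inter isOpen_Ioo
    have hJne : J.Nonempty := ⟨t₀, mem_ball_self (by positivity), ht₀⟩
    have hpos : 0 < volume J := hJo.measure_pos volume hJne
    have hsub : J ⊆ {t | ¬ P t} ∩ Ioo (-1 : ℝ) 0 := fun t ht =>
      ⟨fun hPt => (lt_irrefl _ ((hcon t ht.2 hPt).trans_lt (mem_ball.1 ht.1))).elim, ht.2⟩
    have h0 : volume J = 0 := by
      refine measure_mono_null hsub ?_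
      rwa [Measure.restrict_apply' measurableSet_Ioo] at hnull
    exact hpos.ne' h0
  choose u hu hdist using hstep
  refine ⟨u, hu, tendsto_iff_dist_tendsto_zero.2 ?_⟩
  refine squeeze_zero (fun n => dist_nonneg) (fun n => (hdist n).le) ?_
  exact tendsto_one_div_add_atTop_nhds_zero_nat

/-- **The energy class for the continuous representative at every time** (the hypothesis `hA`
of `isRegularAtOrigin_of_step3Bounds`): if `∫_𝒞 |v(t)|² ≤ C` for a.e. `t ∈ ]-1, 0[`, `v = V`
a.e. on `Q`, and `V` is continuous on `Q` (`IsSmoothAxisymmetricSolutionOn`), then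
`∫_𝒞 |V(t)|² ≤ C` for EVERY `t ∈ ]-1, 0[` (slice the a.e. identity, pick good times `tₙ → t`,
and apply Fatou with `V(tₙ, x) → V(t, x)` on `𝒞`). [cite: Seregin2022LocalAxisym, §2 Step 1 and Def. 1.1 (arXiv:2201.00153 pp. 2, 5), the class L_{2,∞}(Q)] -/
theorem energy_bound_repr (hV : SereginZajaczkowski2007.IsSmoothAxisymmetricSolutionOn
      (SereginSverak2009.parCylOpens 0 1) V q)
    (hae : uncurry v =ᵐ[volume.restrict (SereginSverak2009.parCyl (0 : ℝ × EuclideanSpace ℝ (Fin 3)) 1)] uncurry V)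
    {C : ℝ≥0} (hA : ∀ᵐ t ∂(volume.restrict (Ioo (-1 : ℝ) 0)),
      ∫⁻ x in SereginSverak2009.spaceCyl (0 : EuclideanSpace ℝ (Fin 3)) 1, ‖v t x‖ₑ ^ 2 ≤ C) :
    ∀ t ∈ Ioo (-1 : ℝ) 0, ∫⁻ x in SereginSverak2009.spaceCyl (0 : EuclideanSpace ℝ (Fin 3)) 1, ‖V t x‖ₑ ^ 2 ≤ C := by
  set S : Set (EuclideanSpace ℝ (Fin 3)) := SereginSverak2009.spaceCyl 0 1 with hSdef
  have hSo : IsOpen S := SereginSverak2009.isOpen_spaceCyl 0 1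
  have hcont : ContinuousOn (uncurry V) (SereginSverak2009.parCyl 0 1) := hV.continuousOn_velocity
  -- good times: the bound holds for `V`
  have hgood : ∀ᵐ t ∂(volume.restrict (Ioo (-1 : ℝ) 0)), ∫⁻ x in S, ‖V t x‖ₑ ^ 2 ≤ C := by
    filter_upwards [hA, ae_ae_eq_of_ae_eq_parCyl hae] with t ht heq
    have e : ∫⁻ x in S, ‖V t x‖ₑ ^ 2 = ∫⁻ x in S, ‖v t x‖ₑ ^ 2 :=
      lintegral_congr_ae (heq.mono fun x hx => by simp only; rw [hx])
    rw [e]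
    exact ht
  intro t₀ ht₀
  obtain ⟨u, hu, hlim⟩ := exists_seq_tendsto_of_ae hgood ht₀
  -- slices are continuous on `𝒞`, pointwise convergence along `u`
  have hslice : ∀ t ∈ Ioo (-1 : ℝ) 0, ContinuousOn (V t) S := fun t ht =>
    hcont.comp (continuousOn_const.prodMk continuousOn_id) fun x hx =>
      SereginSverak2009.mem_parCyl_zero.2 ⟨by simpa using ht,
        by simpa using (SereginSverak2009.mem_spaceCyl.1 hx).1,
        by simpa using (SereginSverak2009.mem_spaceCyl.1 hx).2⟩
  have hmeas : ∀ n, AEMeasurable (fun x => ‖V (u n) x‖ₑ ^ 2) (volume.restrict S) := fun n =>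
    (((hslice (u n) (hu n).1).aestronglyMeasurable hSo.measurableSet).aemeasurable.enorm.pow_const _)
  have hptw : ∀ x ∈ S, Tendsto (fun n => ‖V (u n) x‖ₑ ^ 2) atTop (𝓝 (‖V t₀ x‖ₑ ^ 2)) := by
    intro x hx
    have hz : ((t₀, x) : ℝ × EuclideanSpace ℝ (Fin 3)) ∈ SereginSverak2009.parCyl 0 1 :=
      SereginSverak2009.mem_parCyl_zero.2 ⟨by simpa using ht₀,
        by simpa using (SereginSverak2009.mem_spaceCyl.1 hx).1,
        by simpa using (SereginSverak2009.mem_spaceCyl.1 hx).2⟩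
    have hseq : Tendsto (fun n => ((u n, x) : ℝ × EuclideanSpace ℝ (Fin 3))) atTop
        (𝓝[SereginSverak2009.parCyl 0 1] (t₀, x)) := by
      refine tendsto_nhdsWithin_iff.2 ⟨(hlim.prodMk_nhds tendsto_const_nhds), Eventually.of_forall fun n => ?_⟩
      exact SereginSverak2009.mem_parCyl_zero.2 ⟨by simpa using (hu n).1,
        by simpa using (SereginSverak2009.mem_spaceCyl.1 hx).1,
        by simpa using (SereginSverak2009.mem_spaceCyl.1 hx).2⟩
    have hV' : Tendsto (fun n => V (u n) x) atTop (𝓝 (V t₀ x)) := (hcont (t₀, x) hz).tendsto.comp hseq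
    exact ((ENNReal.continuous_pow 2).tendsto _).comp hV'.enorm
  have hlim_eq : ∀ᵐ x ∂(volume.restrict S), liminf (fun n => ‖V (u n) x‖ₑ ^ 2) atTop = ‖V t₀ x‖ₑ ^ 2 := by
    filter_upwards [ae_restrict_mem hSo.measurableSet] with x hx using (hptw x hx).liminf_eq
  calc ∫⁻ x in S, ‖V t₀ x‖ₑ ^ 2 = ∫⁻ x in S, liminf (fun n => ‖V (u n) x‖ₑ ^ 2) atTop :=
        lintegral_congr_ae (hlim_eq.mono fun x hx => hx.symm)
    _ ≤ liminf (fun n => ∫⁻ x in S, ‖V (u n) x‖ₑ ^ 2) atTop := lintegral_liminf_le' hmeas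
    _ ≤ liminf (fun _ : ℕ => (C : ℝ≥0∞)) atTop := liminf_le_liminf (Eventually.of_forall fun n => (hu n).2)
    _ = C := liminf_const _

/-- **Measurability of the representative on the sub-cylinders** `Q(r) ⊆ Q`, `0 ≤ r ≤ 1` (the
hypothesis of `cubicC_le_of_twoSeven`), from the suitable weak class of `V` on `Q`. [folklore] -/
theorem aestronglyMeasurable_repr (hV : SereginZajaczkowski2007.IsSmoothAxisymmetricSolutionOn
      (SereginSverak2009.parCylOpens 0 1) V q) {r : ℝ} (hr : 0 ≤ r) (hr1 : r ≤ 1) :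
    AEStronglyMeasurable (uncurry V) (volume.restrict (SereginSverak2009.parCyl (0 : ℝ × EuclideanSpace ℝ (Fin 3)) r)) :=
  hV.suitable.distributional.1.aestronglyMeasurable.mono_measure
    (Measure.restrict_mono ((SereginSverak2009.parCyl_mono 0 hr hr1).trans
      (subset_of_eq (SereginSverak2009.coe_parCylOpens 0 1).symm)) le_rfl)

end Repr

end Summit.NavierStokesRegularity.NavierStokesRegularity.Theorems.AxisymmetricKatoGlobal.EulerScaling

end
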